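import Literature.Geometry.Kaehler.ComplexTorusMixedHodgeRiemannTwoZero
import HarnessLib

/-!
# The mixed Hodge–Riemann bilinear relation in bidegree `(p,0)` on a complex torus, for every `p`:
# `(-1)^{p(p-1)/2} iᵖ ∫_X B ∧ B̄ ∧ ω_1 ∧ ⋯ ∧ ω_n > 0` for `0 ≠ B ∈ H^{p,0}(X)` and Kähler classes `ω_m`
# (Dinh–Nguyên 2006, Thm. 1.3 / Prop. 2.1 (b) with `q = 0`; Timorin 1998)

Layer `Literature/Geometry/Kaehler`, namespace `Literature.Geometry.Kaehler.ComplexTorus`; lane `lit-hodgefound`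
(Track 2 foundations library, Layer A: Hodge theory of complex tori on invariant forms), seat p16, generation 23
(row g23-#2). Generalisation of `ComplexTorusMixedHodgeRiemannTwoZero` (row g22-#1, FILE 1: the case `p = 2`,
sign `(-1)^{1} i² = 1`) from `(2,0)`-classes to `(p,0)`-classes of EVERY degree `p`, with Huybrechts' sign
`(-1)^{k(k-1)/2} i^{p-q}` (`k = p`, `q = 0`) of the tree's unmixed `hodgeRiemann_voisin_of_pos`. For `q = 0`
Dinh–Nguyên's mixed-primitivity condition `[α] ∧ [Ω] ∧ [ω_{n-p+1}] = 0` is void (a class of type `(n+1, ·)`),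
so `P^{p,0}(X) = H^{p,0}(X)` and Theorem 1.3 says: `Q` is positive definite on all of `H^{p,0}(X)`. The
computation is the one of FILE 1 in the ring of graded forms `GForm E ℂ`, with one more sign: a `p`-form passes
the `n` conjugate covectors of the background with `(-1)^{np}`. THEOREMS ONLY: no definition, no named fact
(net debt 0).

## Sources (verbatim, held copies)

* T.-C. Dinh, V.-A. Nguyên, *The mixed Hodge–Riemann bilinear relations for compact Kähler manifolds*, GAFA 16
  (2006) 838–849 [DinhNguyen2006] (held `paper:arxiv-math_0501449`), p. 3 (p0003 L70–L110): "Fix non-negative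
  integers `p, q` such that `p + q ≤ n`. Let `ω_1, …, ω_{n-p-q+1}` be Kähler forms. Put `Ω := ω_1 ∧ ⋯ ∧ ω_{n-p-q}`.
  […] `P^{p,q}(X) := {[α] ∈ H^{p,q}(X) : [α] ∧ [Ω] ∧ [ω_{n-p-q+1}] = 0}` […]
  `Q([α],[β]) := i^{p-q} (-1)^{(n-p-q)(n-p-q-1)/2} ∫_X α ∧ β̄ ∧ Ω`. […] **Theorem 1.3. (Timorin's Theorem)** If `X`
  is a complex torus of dimension `n`, then `Q(·,·)` is positive definite on `P^{p,q}(X)`."; p. 5 (p0005 L15–L45)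
  **Prop. 2.1** (the linear context): "(b) `Q(·,·)` is positive definite on `P^{p,q}(ℂⁿ)`. […] Proof. See
  Proposition 1, the Main Theorem and Corollary 2 in [Timorin 1998]."
* V. A. Timorin, *Mixed Hodge–Riemann bilinear relations in a linear context*, Funct. Anal. Appl. 32 (1998)
  268–272 [Timorin1998], Main Theorem.
* D. Huybrechts, *Complex Geometry* (2005) [Huybrechts2005], **Cor. 1.2.36**: "`i^{p-q} Q(α, ᾱ) =
  (n - (p+q))! · ⟨α, α⟩_ℂ > 0`" with `Q(α, β) = (-1)^{k(k-1)/2} α ∧ β ∧ ω^{n-k}` (the unmixed sign convention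
  vendored here, as in the tree's `hodgeRiemann_voisin_of_pos`); C. Voisin, *Hodge Theory and Complex Algebraic
  Geometry I* (2002) [VoisinHodgeI2002], §6.3.2 Thm. 6.32, §2.3.1.
* E. M. Chirka, *Complex Analytic Sets* (1989) [Chirka1989], App. A4.5 (principal positive forms
  `π_l = (i/2) l ∧ l̄`, decomposition of positive `(1,1)`-forms, positivity on positive vectors).
* H. Lange, *Abelian Varieties over the Complex Numbers* (2023) [Lange2023AbelianVarietiesComplex], §1.1.5
  Lemma 1.1.22 / Prop. 1.1.23 (`dim Λ^{g,0} = 1`), §2.2.1 Lemma 2.2.2 (a)(ii) and p. 89 (`g`-linearity),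
  §2.2.5 Exercises (1), (2); F. Warner [Warner1983] / [WarnerGTM94], 2.6 (the exterior algebra).

Sign normalisation. As in FILE 1 and `hodgeRiemann_voisin_of_pos`: Kähler form `ω = -η` for a positive
`(1,1)`-form `η`, `∫_X = torusIntegral`, and the Hodge–Riemann number is
`(-1)^{p(p-1)/2} iᵖ ∫_X ω_1 ∧ ⋯ ∧ ω_n ∧ B ∧ B̄` (Huybrechts' `(-1)^{k(k-1)/2} i^{p-q}` with `k = p`, `q = 0`; for
`p = 2` the sign is `+1` and the statement is FILE 1's). Dinh–Nguyên print `i^{p-q} (-1)^{(n-p-q)(n-p-q-1)/2}` in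
front of `∫ α ∧ β̄ ∧ Ω`; no sign of theirs is vendored.

## What is proved, and how

`E` a complex normed space of dimension `n + p`, `X = E/Φ(ℤ^ι)`, `B ∈ Λ^{p,0} = typeSubmodule E p p 0`
(`= H^{p,0}(X)`), `Θ = (θ_m)` a family of `n` complex `2`-forms (the background), `Ω = wedgeFamily n Θ`, and the
Hodge–Riemann form `HR(Θ, B) := ((-1)^{C(p,2)} iᵖ) • (Ω ∧ (B ∧ B̄))` read in degree `2(n+p)`.

* §1 (the heart, in `GForm E ℂ`). For a complex basis `u` (coordinate covectors `φ_a`) and functionals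
  `l_1, …, l_n`: **`(-1)^{C(p,2)} iᵖ · π_{l_1} ∧ ⋯ ∧ π_{l_n} ∧ B ∧ B̄ = 2ᵖ|c|² · π_{φ_1} ∧ ⋯ ∧ π_{φ_{n+p}}`**
  (`exists_smul_wedgeFamily_wedge_pZero_eq_smul`), `c` the coordinate of the `(n+p, 0)`-form `l_1 ∧ ⋯ ∧ l_n ∧ B` on
  the line `Λ^{n+p,0} = ℂ · φ_1 ∧ ⋯ ∧ φ_{n+p}`: `∏ π_{l_m} = (i/2)ⁿ (-1)^{C(n,2)} (∏ l_m)(∏ l̄_m)`,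
  `(∏ l̄_m) B = (-1)^{np} B (∏ l̄_m)`, `(∏ l_m) B = c ∏ φ_a`, `(∏ φ_a)(∏ φ̄_a) = (-1)^{C(n+p,2)} (2/i)^{n+p} ∏ π_{φ_a}`,
  and `C(n+p,2) = C(n,2) + np + C(p,2)` makes all signs cancel against `(-1)^{C(p,2)} iᵖ`.
* §2 (pointwise positivity). `HR(π_l, B) ≥ 0` on the complex orientation frame (value `2ᵖ|c|² |det|²`), hence
  for every SEMI-positive `(1,1)` background by Chirka's decomposition and `g`-linearity
  (`smul_wedgeFamily_wedge_pZero_apply_interleave_nonneg_of_semipos`).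
* §3 (the theorem). **`(-1)^{C(p,2)} iᵖ ∫_X (-η_1) ∧ ⋯ ∧ (-η_n) ∧ B ∧ B̄ ≥ 0`** for semi-positive `η_m`
  (`torusIntegral_pZero_nonneg_of_semipos`) and **`> 0`** for positive `η_m` and `B ≠ 0`
  (`torusIntegral_pZero_pos_of_pos` — Dinh–Nguyên Thm. 1.3 / Prop. 2.1 (b) for `(p,q) = (p,0)` on a torus;
  `IsRiemannForm.torusIntegral_pZero_pos` for polarisations): `η_m - ε_m η_0 ≥ 0`, expansion, every term `≥ 0`,
  and the term `∏ ε_m · (unmixed number) > 0` by the tree's `hodgeRiemann_voisin_of_pos` (Voisin Thm. 6.32; every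
  `(p,0)`-class is primitive for degree reasons).
* §4 Readings: `p = 1` (**`i ∫_X α ∧ ᾱ ∧ ω_1 ∧ ⋯ ∧ ω_n > 0` for `0 ≠ α ∈ H^{1,0}(X)`**, the mixed polarisation of
  `H¹`), and bidegree `(0,p)` by conjugation.
-/

noncomputable section

open scoped ComplexConjugate ComplexOrder
open Complex Function Module
open Literature.LinearAlgebra.Alternating
open Literature.Analysis.Complex (oneForm₀ oneForm₀_apply IsOfTypeAt typeSubmodule isOfTypeAt_of_mem_typeSubmodule)

namespace Literature.Geometry.Kaehler

namespace ComplexTorus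

/-! ## §1 The identity `(-1)^{C(p,2)} iᵖ · π_{l_1} ∧ ⋯ ∧ π_{l_n} ∧ B ∧ B̄ = 2ᵖ|c|² · π_{φ_1} ∧ ⋯ ∧ π_{φ_{n+p}}` -/

section Identity

variable {E : Type*} [NormedAddCommGroup E] [NormedSpace ℂ E]

/-- `C(n + p, 2) = C(n, 2) + n p + C(p, 2)`. [folklore] -/
private theorem add_choose_two (n : ℕ) : ∀ p : ℕ, (n + p).choose 2 = n.choose 2 + n * p + p.choose 2
  | 0 => by simp
  | p + 1 => by
    have h1 : (n + (p + 1)).choose 2 = (n + p) + (n + p).choose 2 := by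
      rw [← add_assoc, show 2 = 1 + 1 from rfl, Nat.choose_succ_succ, Nat.choose_one_right]
    have h2 : (p + 1).choose 2 = p + p.choose 2 := by
      rw [show 2 = 1 + 1 from rfl, Nat.choose_succ_succ, Nat.choose_one_right]
    rw [h1, h2, add_choose_two n p]
    ring

/-- Real sign factors act through `ℂ`. [folklore] -/
private theorem neg_one_pow_real_smul' (k : ℕ) (w : GForm E ℂ) : ((-1 : ℝ) ^ k) • w = ((-1 : ℂ) ^ k) • w := by
  rw [← GForm.coe_real_smul]; push_cast; rfl

/-- The scalar bookkeeping: `(-1)^{C(p,2)} iᵖ (i/2)ⁿ (-1)^{C(n,2)} (-1)^{np} c c̄ (-1)^{C(n+p,2)} = 2ᵖ|c|² (i/2)^{n+p}`.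
[folklore] -/
private theorem pZero_scalar (n p : ℕ) (c : ℂ) :
    (-1 : ℂ) ^ (p.choose 2) * I ^ p *
        ((I / 2) ^ n * ((-1 : ℂ) ^ (n.choose 2) * ((-1 : ℂ) ^ (n * p) * (c * conj c) * (-1 : ℂ) ^ ((n + p).choose 2)))) =
      ((2 ^ p * Complex.normSq c : ℝ) : ℂ) * (I / 2) ^ (n + p) := by
  have h1 : ∀ k : ℕ, (-1 : ℂ) ^ k * (-1 : ℂ) ^ k = 1 := fun k ↦ by
    rw [← pow_add, ← two_mul, pow_mul, neg_one_sq, one_pow]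
  have hI : (2 : ℂ) ^ p * (I / 2) ^ p = I ^ p := by
    rw [← mul_pow, mul_div_cancel₀ _ (two_ne_zero)]
  rw [add_choose_two, pow_add, pow_add, Complex.mul_conj]
  push_cast
  linear_combination (I ^ p * (I / 2) ^ n * ((Complex.normSq c : ℝ) : ℂ) * ((-1 : ℂ) ^ (n.choose 2)) ^ 2 *
      ((-1 : ℂ) ^ (n * p)) ^ 2) * h1 (p.choose 2) +
    (I ^ p * (I / 2) ^ n * ((Complex.normSq c : ℝ) : ℂ) * ((-1 : ℂ) ^ (n * p)) ^ 2) * h1 (n.choose 2) +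
    (I ^ p * (I / 2) ^ n * ((Complex.normSq c : ℝ) : ℂ)) * h1 (n * p) -
    (((Complex.normSq c : ℝ) : ℂ) * (I / 2) ^ n) * hI

/-- A wedge word of `ℂ`-linear covectors followed by a `(p,0)`-form has type `(n + p, 0)`.
[cite: Lange2023AbelianVarietiesComplex, §1.1.5 Prop. 1.1.23] [cite: VoisinHodgeI2002, §2.3.1] -/
theorem wedgeWord_wedge_mem_typeSubmodule_pZero {n p : ℕ} (l : Fin n → (E →L[ℂ] ℂ))
    {B : E [⋀^Fin p]→L[ℝ] ℂ} (hB : B ∈ typeSubmodule E p p 0) :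
    (wedgeWord (fun i ↦ ((l i : E →L[ℂ] ℂ).restrictScalars ℝ : E →L[ℝ] ℂ)) (oneForm₀ E) n (fun i ↦ i)).wedge B ∈
      typeSubmodule E (n + p) (n + p) 0 :=
  ((isOfTypeAt_wedgeWord_restrictScalars l n _).wedge (isOfTypeAt_of_mem_typeSubmodule rfl hB)).mem_typeSubmodule

variable [FiniteDimensional ℂ E]

/-- **The mixed Hodge–Riemann monomial of a `(p,0)`-form against principal forms is a non-negative multiple of the
coordinate monomial.** For a complex basis `u` of `E` (`dim_ℂ E = n + p`, coordinate functionals `φ_a`), functionals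
`l_1, …, l_n` and `B ∈ Λ^{p,0}`:
`(-1)^{C(p,2)} iᵖ · π_{l_1} ∧ ⋯ ∧ π_{l_n} ∧ B ∧ B̄ = 2ᵖ|c|² · π_{φ_1} ∧ ⋯ ∧ π_{φ_{n+p}}` (read in degree `2(n+p)`),
where `c` is the coordinate of the `(n+p, 0)`-form `l_1 ∧ ⋯ ∧ l_n ∧ B` on the line
`Λ^{n+p,0} = ℂ · φ_1 ∧ ⋯ ∧ φ_{n+p}`. Computation in the ring of graded forms as in FILE 1, with the extra sign
`(∏ l̄_m) B = (-1)^{np} B (∏ l̄_m)`; the pointwise content of Dinh–Nguyên's Prop. 2.1 (b) for `(p,q) = (p,0)` (no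
primitivity condition). [cite: DinhNguyen2006, §2 Prop. 2.1 (b) (arXiv PDF p. 5)] [cite: Timorin1998, Main Theorem]
[cite: Chirka1989, App. A4.5 (Positive forms)] [cite: Huybrechts2005, Cor. 1.2.36] -/
theorem exists_smul_wedgeFamily_wedge_pZero_eq_smul {n p : ℕ} (u : Module.Basis (Fin (n + p)) ℂ E)
    (l : Fin n → (E →L[ℂ] ℂ)) {B : E [⋀^Fin p]→L[ℝ] ℂ} (hB : B ∈ typeSubmodule E p p 0)
    (h2 : 2 * n + (p + p) = 2 * (n + p)) :
    ∃ c : ℂ, ((-1 : ℂ) ^ (p.choose 2) * I ^ p) •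
        (((wedgeFamily n fun m ↦ principalTwoForm (l m)).wedge (B.wedge (conjForm B))).domDomCongr (finCongr h2)) =
      ((2 ^ p * Complex.normSq c : ℝ) : ℂ) • wedgeFamily (n + p) (fun a ↦ principalTwoForm (basisCoordCLM u a)) := by
  -- letters
  set ℓ : Fin n → (E →L[ℝ] ℂ) := fun m ↦ (l m : E →L[ℂ] ℂ).restrictScalars ℝ with hℓ
  set φ : Fin (n + p) → (E →L[ℝ] ℂ) := fun a ↦ (basisCoordCLM u a : E →L[ℂ] ℂ).restrictScalars ℝ with hφ
  set x : Fin n → GForm E ℂ := fun m ↦ GForm.of 1 (wedgeOne (ℓ m) (oneForm₀ E)) with hx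
  set xb : Fin n → GForm E ℂ := fun m ↦
    GForm.of 1 (wedgeOne (conjCLE.toContinuousLinearMap.comp (ℓ m)) (oneForm₀ E)) with hxb
  set y : Fin (n + p) → GForm E ℂ := fun a ↦ GForm.of 1 (wedgeOne (φ a) (oneForm₀ E)) with hy
  set yb : Fin (n + p) → GForm E ℂ := fun a ↦
    GForm.of 1 (wedgeOne (conjCLE.toContinuousLinearMap.comp (φ a)) (oneForm₀ E)) with hyb
  -- the `(n+p, 0)`-form `l_1 ∧ ⋯ ∧ l_n ∧ B` on the line `ℂ · φ_1 ∧ ⋯ ∧ φ_{n+p}`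
  set Λ := wedgeWord ℓ (oneForm₀ E) n (fun i ↦ i) with hΛdef
  set Y := wedgeWord φ (oneForm₀ E) (n + p) (fun i ↦ i) with hYdef
  have hG : Λ.wedge B ∈ typeSubmodule E (n + p) (n + p) 0 := wedgeWord_wedge_mem_typeSubmodule_pZero l hB
  obtain ⟨c, hc⟩ := exists_eq_smul_wedgeWord_basisCoord u hG
  refine ⟨c, GForm.of_injective (2 * (n + p)) ?_⟩
  -- both sides as products in `GForm E ℂ`
  have hΛ : GForm.of n Λ = (List.ofFn x).prod := gof_wedgeWord ℓ n fun i ↦ i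
  have hY : GForm.of (n + p) Y = (List.ofFn y).prod := gof_wedgeWord φ (n + p) fun i ↦ i
  have hxb_conj : GForm.conjG (List.ofFn x).prod = (List.ofFn xb).prod := by
    rw [conjG_prod_ofFn]
    exact congrArg (fun f : Fin n → GForm E ℂ ↦ (List.ofFn f).prod) (funext fun m ↦ conjG_gof_one _)
  have hyb_conj : GForm.conjG (List.ofFn y).prod = (List.ofFn yb).prod := by
    rw [conjG_prod_ofFn]
    exact congrArg (fun f : Fin (n + p) → GForm E ℂ ↦ (List.ofFn f).prod) (funext fun a ↦ conjG_gof_one _)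
  have hP : (List.ofFn fun m ↦ GForm.of 2 (principalTwoForm (l m))).prod =
      (I / 2) ^ n • (((-1 : ℂ) ^ (n.choose 2)) • ((List.ofFn x).prod * (List.ofFn xb).prod)) := by
    rw [show (fun m ↦ GForm.of 2 (principalTwoForm (l m))) = fun m ↦ (I / 2) • (x m * xb m) from
      funext fun m ↦ gof_principalTwoForm (l m), prod_ofFn_smul,
      prod_ofFn_mul_eq n x xb (fun m ↦ isHomog_gof_one _) (fun m ↦ isHomog_gof_one _), neg_one_pow_real_smul']
  have hPφ : (List.ofFn fun a ↦ GForm.of 2 (principalTwoForm (basisCoordCLM u a))).prod =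
      (I / 2) ^ (n + p) • (List.ofFn fun a ↦ y a * yb a).prod := by
    rw [show (fun a ↦ GForm.of 2 (principalTwoForm (basisCoordCLM u a))) = fun a ↦ (I / 2) • (y a * yb a) from
      funext fun a ↦ gof_principalTwoForm (basisCoordCLM u a), prod_ofFn_smul]
  have hsplitφ : (List.ofFn y).prod * (List.ofFn yb).prod =
      ((-1 : ℂ) ^ ((n + p).choose 2)) • (List.ofFn fun a ↦ y a * yb a).prod := by
    rw [prod_ofFn_mul_eq (n + p) y yb (fun a ↦ isHomog_gof_one _) (fun a ↦ isHomog_gof_one _),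
      neg_one_pow_real_smul', smul_smul, ← pow_add, ← two_mul, pow_mul, neg_one_sq, one_pow, one_smul]
  -- `(∏ l_m) · B = c · ∏ φ_a` and its conjugate
  have hXb : (List.ofFn x).prod * GForm.of p B = c • (List.ofFn y).prod := by
    rw [← hΛ, GForm.of_mul_of, hc, GForm.of_smul, hY]
  have hXbb : (List.ofFn xb).prod * GForm.of p (conjForm B) = conj c • (List.ofFn yb).prod := by
    rw [← hxb_conj, ← GForm.conjG_of, ← conjG_mul, hXb, GForm.conjG_smul, hyb_conj]
  -- the new sign: `(∏ l̄_m) · B = (-1)^{np} · B · (∏ l̄_m)`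
  have hcomm : (List.ofFn xb).prod * GForm.of p B = ((-1 : ℂ) ^ (n * p)) • (GForm.of p B * (List.ofFn xb).prod) := by
    have h := GForm.IsHomog.mul_comm_sign (GForm.IsHomog.of p B) (isHomog_prod_ofFn n xb fun m ↦ isHomog_gof_one _)
    rw [h, mul_comm p n, neg_one_pow_real_smul']
  -- assemble
  rw [GForm.of_smul, GForm.of_smul, GForm.of_domDomCongr_finCongr, ← GForm.of_mul_of, ← GForm.of_mul_of,
    gof_wedgeFamily, gof_wedgeFamily, hP, hPφ]
  have hcore : (List.ofFn x).prod * (List.ofFn xb).prod * (GForm.of p B * GForm.of p (conjForm B)) =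
      ((-1 : ℂ) ^ (n * p) * (c * conj c) * (-1 : ℂ) ^ ((n + p).choose 2)) • (List.ofFn fun a ↦ y a * yb a).prod := by
    calc (List.ofFn x).prod * (List.ofFn xb).prod * (GForm.of p B * GForm.of p (conjForm B))
        = (List.ofFn x).prod * ((List.ofFn xb).prod * GForm.of p B) * GForm.of p (conjForm B) := by
          simp only [mul_assoc]
      _ = ((-1 : ℂ) ^ (n * p)) •
            (((List.ofFn x).prod * GForm.of p B) * ((List.ofFn xb).prod * GForm.of p (conjForm B))) := by
          rw [hcomm, mul_csmul, csmul_mul]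
          simp only [mul_assoc]
      _ = ((-1 : ℂ) ^ (n * p) * (c * conj c) * (-1 : ℂ) ^ ((n + p).choose 2)) •
            (List.ofFn fun a ↦ y a * yb a).prod := by
          rw [hXb, hXbb, csmul_mul, mul_csmul, smul_smul, hsplitφ, smul_smul, smul_smul]
          congr 1
          ring
  rw [csmul_mul, csmul_mul, hcore]
  simp only [smul_smul]
  congr 1
  linear_combination pZero_scalar n p c

end Identity

/-! ## §2 Pointwise positivity of `(-1)^{C(p,2)} iᵖ · Ω ∧ B ∧ B̄` on the complex orientation frame -/

section Positivity

variable {E : Type*} [NormedAddCommGroup E] [NormedSpace ℂ E]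

/-- `w ↦ K • (w ∧ C)` (read in another degree) is a `ℂ`-linear map. [folklore] -/
private theorem exists_linear_smul_wedge_domDomCongr {a b d : ℕ} (K : ℂ) (C : E [⋀^Fin b]→L[ℝ] ℂ) (h : a + b = d) :
    ∃ T : (E [⋀^Fin a]→L[ℝ] ℂ) →ₗ[ℂ] (E [⋀^Fin d]→L[ℝ] ℂ), ∀ w, T w = K • (w.wedge C).domDomCongr (finCongr h) :=
  ⟨K • { toFun := fun w ↦ (w.wedge C).domDomCongr (finCongr h)
         map_add' := fun w w' ↦ by
           show ((w + w').wedge C).domDomCongr (finCongr h) = _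
           rw [ContinuousAlternatingMap.wedge_add_left, ContinuousAlternatingMap.domDomCongr_add]
         map_smul' := fun z w ↦ by
           show ((z • w).wedge C).domDomCongr (finCongr h) = _
           rw [wedge_smul_left_complex]
           rfl },
    fun w ↦ rfl⟩

/-- **Multilinear expansion in the background slots through a linear read-out**
`T(⋀_m Σ_k c_{mk} θ_{mk}) = Σ_r (∏_m c_{m,r(m)}) · T(⋀_m θ_{m,r(m)})` ("`g`-linearity of intersection numbers").
[cite: Lange2023AbelianVarietiesComplex, §2.2.1 p. 89] [cite: WarnerGTM94, 2.6] -/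
theorem linear_wedgeFamily_sum_smul {n : ℕ} {M : Type*} [AddCommGroup M] [Module ℂ M]
    (T : (E [⋀^Fin (2 * n)]→L[ℝ] ℂ) →ₗ[ℂ] M) {κ : Type*} [Fintype κ] (c : Fin n → κ → ℂ)
    (θ : Fin n → κ → E [⋀^Fin 2]→L[ℝ] ℂ) :
    T (wedgeFamily n fun m ↦ ∑ k, c m k • θ m k) =
      ∑ r : Fin n → κ, (∏ m, c m (r m)) • T (wedgeFamily n fun m ↦ θ m (r m)) := by
  classical
  rw [← wedgeFamilyMultilinear_apply, MultilinearMap.map_sum (wedgeFamilyMultilinear n) fun m k ↦ c m k • θ m k,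
    map_sum]
  refine Finset.sum_congr rfl fun r _ ↦ ?_
  rw [MultilinearMap.map_smul_univ (wedgeFamilyMultilinear n) (fun m ↦ c m (r m)) (fun m ↦ θ m (r m)), map_smul,
    wedgeFamilyMultilinear_apply]

/-- The same expansion for a sum of two backgrounds: `T(⋀_m (θ_m + θ'_m)) = Σ_s T(⋀_m (s.piecewise θ θ')_m)`.
[cite: Lange2023AbelianVarietiesComplex, §2.2.1 p. 89] [cite: WarnerGTM94, 2.6] -/
theorem linear_wedgeFamily_add {n : ℕ} {M : Type*} [AddCommGroup M] [Module ℂ M]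
    (T : (E [⋀^Fin (2 * n)]→L[ℝ] ℂ) →ₗ[ℂ] M) (θ θ' : Fin n → E [⋀^Fin 2]→L[ℝ] ℂ) :
    T (wedgeFamily n (θ + θ')) = ∑ s : Finset (Fin n), T (wedgeFamily n (s.piecewise θ θ')) := by
  classical
  rw [← wedgeFamilyMultilinear_apply, MultilinearMap.map_add_univ, map_sum]
  rfl

/-- Scaling the background through a linear read-out: `T(⋀_m c_m θ_m) = (∏ c_m) · T(⋀_m θ_m)`.
[cite: Lange2023AbelianVarietiesComplex, §2.2.1 p. 89] [cite: WarnerGTM94, 2.6] -/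
theorem linear_wedgeFamily_smul {n : ℕ} {M : Type*} [AddCommGroup M] [Module ℂ M]
    (T : (E [⋀^Fin (2 * n)]→L[ℝ] ℂ) →ₗ[ℂ] M) (c : Fin n → ℂ) (θ : Fin n → E [⋀^Fin 2]→L[ℝ] ℂ) :
    T (wedgeFamily n fun m ↦ c m • θ m) = (∏ m, c m) • T (wedgeFamily n θ) := by
  classical
  rw [← wedgeFamilyMultilinear_apply, ← wedgeFamilyMultilinear_apply,
    MultilinearMap.map_smul_univ (wedgeFamilyMultilinear n) c θ, map_smul]

variable [FiniteDimensional ℂ E]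

/-- **Mixed Hodge–Riemann in bidegree `(p,0)`, pointwise, principal background**: for `B ∈ Λ^{p,0}` and
functionals `l_1, …, l_n` the top form `(-1)^{C(p,2)} iᵖ · π_{l_1} ∧ ⋯ ∧ π_{l_n} ∧ B ∧ B̄` is `≥ 0` on the complex
orientation frame `(u_1, iu_1, …)` of any complex basis `u` (value `2ᵖ|c|² |det|²`).
[cite: DinhNguyen2006, §2 Prop. 2.1 (b) (arXiv PDF p. 5)] [cite: Timorin1998, Main Theorem]
[cite: Chirka1989, App. A4.5 (value of a positive (p,p)-form on a positive 2p-vector)] -/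
theorem smul_wedgeFamily_wedge_pZero_principal_apply_interleave_nonneg {n p : ℕ}
    (u : Module.Basis (Fin (n + p)) ℂ E) (l : Fin n → (E →L[ℂ] ℂ)) {B : E [⋀^Fin p]→L[ℝ] ℂ}
    (hB : B ∈ typeSubmodule E p p 0) (h2 : 2 * n + (p + p) = 2 * (n + p)) :
    0 ≤ (((-1 : ℂ) ^ (p.choose 2) * I ^ p) •
        (((wedgeFamily n fun m ↦ principalTwoForm (l m)).wedge (B.wedge (conjForm B))).domDomCongr (finCongr h2)))
      (fun m ↦ Sum.elim (⇑u) (fun j ↦ I • u j) (finTwoMulEquivSum (n + p) m)) := by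
  obtain ⟨c, hc⟩ := exists_smul_wedgeFamily_wedge_pZero_eq_smul u l hB h2
  rw [hc, ContinuousAlternatingMap.smul_apply, wedgeFamily_principalTwoForm_apply_interleave_eq, smul_eq_mul]
  exact mul_nonneg (Complex.zero_le_real.2 (mul_nonneg (pow_nonneg zero_le_two _) (Complex.normSq_nonneg _)))
    (Complex.zero_le_real.2 (Complex.normSq_nonneg _))

/-- **Mixed Hodge–Riemann in bidegree `(p,0)`, pointwise, semi-positive background** (Chirka's decomposition of
each semi-positive `-η_m` into principal forms and `g`-linearity): for real `(1,1)`-forms `η_1, …, η_n` with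
`η_m(iv, v) ≥ 0` and `B ∈ Λ^{p,0}`, `(-1)^{C(p,2)} iᵖ · (-η_1) ∧ ⋯ ∧ (-η_n) ∧ B ∧ B̄ ≥ 0` on the complex orientation
frame. [cite: DinhNguyen2006, §2 Prop. 2.1 (b) (arXiv PDF p. 5)] [cite: Chirka1989, App. A4.5 Example (d)]
[cite: Lange2023AbelianVarietiesComplex, §2.2.5 Exercise (2) (p0097)] -/
theorem smul_wedgeFamily_wedge_pZero_apply_interleave_nonneg_of_semipos {n p : ℕ}
    (u : Module.Basis (Fin (n + p)) ℂ E) (η : Fin n → E [⋀^Fin 2]→L[ℝ] ℝ)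
    (h11 : ∀ m (x y : E), η m ![I • x, I • y] = η m ![x, y]) (hpsd : ∀ m (v : E), 0 ≤ η m ![I • v, v])
    {B : E [⋀^Fin p]→L[ℝ] ℂ} (hB : B ∈ typeSubmodule E p p 0) (h2 : 2 * n + (p + p) = 2 * (n + p)) :
    0 ≤ (((-1 : ℂ) ^ (p.choose 2) * I ^ p) •
        (((wedgeFamily n fun m ↦ ofRealForm (-(η m))).wedge (B.wedge (conjForm B))).domDomCongr (finCongr h2)))
      (fun m ↦ Sum.elim (⇑u) (fun j ↦ I • u j) (finTwoMulEquivSum (n + p) m)) := by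
  classical
  have hg : finrank ℂ E = n + p := by rw [Module.finrank_eq_card_basis u, Fintype.card_fin]
  choose l c hc hdec using fun m ↦ exists_eq_sum_smul_principalTwoForm_of_semipos (η m) (h11 m) (hpsd m) hg
  obtain ⟨T, hT⟩ := exists_linear_smul_wedge_domDomCongr ((-1 : ℂ) ^ (p.choose 2) * I ^ p)
    (B.wedge (conjForm B)) h2
  rw [← hT, show (fun m ↦ ofRealForm (-(η m))) = fun m ↦ ∑ k, (c m k : ℂ) • principalTwoForm (l m k) from
    funext hdec, linear_wedgeFamily_sum_smul, ContinuousAlternatingMap.sum_apply]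
  refine Finset.sum_nonneg fun r _ ↦ ?_
  rw [ContinuousAlternatingMap.smul_apply, smul_eq_mul, hT]
  exact mul_nonneg (Finset.prod_nonneg fun m _ ↦ Complex.zero_le_real.2 (hc m (r m)))
    (smul_wedgeFamily_wedge_pZero_principal_apply_interleave_nonneg u (fun m ↦ l m (r m)) hB h2)

end Positivity

/-! ## §3 The mixed Hodge–Riemann bilinear relation in bidegree `(p,0)`:
`(-1)^{C(p,2)} iᵖ ∫_X (-η_1) ∧ ⋯ ∧ (-η_n) ∧ B ∧ B̄ ≥ 0` (semi-positive), `> 0` (positive, `B ≠ 0`) -/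

section Integral

variable {ι : Type*} [Fintype ι] [DecidableEq ι] {E : Type*} [NormedAddCommGroup E] [NormedSpace ℂ E]
  (Φ : (ι → ℝ) ≃L[ℝ] E)

/-- **`(-1)^{C(p,2)} iᵖ ∫_X (-η_1) ∧ ⋯ ∧ (-η_n) ∧ B ∧ B̄ ≥ 0` for semi-positive `(1,1)`-forms `η_m` and
`B ∈ H^{p,0}(X)`** on a complex torus `X = E/Φ(ℤ^ι)` of dimension `n + p` (Gromov–Timorin–Dinh–Nguyên for
`(p,q) = (p,0)` in the closure of the Kähler cone; the tree's sign convention `c₁ = -η`, Huybrechts' sign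
`(-1)^{k(k-1)/2} i^{p-q}`). [cite: DinhNguyen2006, §1 Theorem 1.3 and §2 Prop. 2.1 (b) (arXiv PDF pp. 3, 5)]
[cite: Timorin1998, Main Theorem] [cite: Lange2023AbelianVarietiesComplex, §2.2.5 Exercise (2) (p0097)] -/
theorem torusIntegral_pZero_nonneg_of_semipos {n p : ℕ} (e : Fin (2 * (n + p)) ≃ ι)
    (η : Fin n → E [⋀^Fin 2]→L[ℝ] ℝ) (h11 : ∀ m (x y : E), η m ![I • x, I • y] = η m ![x, y])
    (hpsd : ∀ m (v : E), 0 ≤ η m ![I • v, v]) {B : E [⋀^Fin p]→L[ℝ] ℂ} (hB : B ∈ typeSubmodule E p p 0)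
    (h2 : 2 * n + (p + p) = 2 * (n + p)) :
    0 ≤ (-1 : ℂ) ^ (p.choose 2) * I ^ p * torusIntegral Φ e
      (((wedgeFamily n fun m ↦ ofRealForm (-(η m))).wedge (B.wedge (conjForm B))).domDomCongr (finCongr h2)) := by
  haveI := finiteDimensional_complex Φ
  have hg : finrank ℂ E = n + p := finrank_eq_of_finTwoMulEquiv Φ e
  rw [← torusIntegral_smul]
  exact torusIntegral_nonneg_of_apply_interleave_nonneg Φ e (Module.finBasisOfFinrankEq ℂ E hg) _
    (smul_wedgeFamily_wedge_pZero_apply_interleave_nonneg_of_semipos _ η h11 hpsd hB h2)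

/-- **The unmixed Hodge–Riemann relation in bidegree `(p,0)` on the torus**: for a positive `(1,1)`-form `η₀`
(`ω = -η₀`) and `0 ≠ B ∈ H^{p,0}(X)`, `(-1)^{C(p,2)} iᵖ ∫_X ω^{∧n} ∧ B ∧ B̄ > 0` — Voisin's Thm. 6.32 with `k = p`,
`(p,q) = (p,0)` (every `(p,0)`-class is primitive for degree reasons: `B ∧ ω^{∧(n+1)}` has type `(n+p+1, n+1)`),
the tree's `hodgeRiemann_voisin_of_pos`. [cite: VoisinHodgeI2002, §6.3.2 Thm. 6.32] [cite: Huybrechts2005, Cor. 1.2.36] -/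
theorem torusIntegral_pZero_const_pos {n p : ℕ} (e : Fin (2 * (n + p)) ≃ ι)
    {η₀ : E [⋀^Fin 2]→L[ℝ] ℝ} (h₀ : ∀ x y : E, η₀ ![I • x, I • y] = η₀ ![x, y])
    (h₀pos : ∀ v : E, v ≠ 0 → 0 < η₀ ![I • v, v]) {B : E [⋀^Fin p]→L[ℝ] ℂ} (hB : B ∈ typeSubmodule E p p 0)
    (hB0 : B ≠ 0) (h2 : 2 * n + (p + p) = 2 * (n + p)) :
    0 < (-1 : ℂ) ^ (p.choose 2) * I ^ p * torusIntegral Φ e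
      (((wedgeFamily n fun _ ↦ ofRealForm (-η₀)).wedge (B.wedge (conjForm B))).domDomCongr (finCongr h2)) := by
  haveI := finiteDimensional_complex Φ
  have hg : finrank ℂ E = n + p := finrank_eq_of_finTwoMulEquiv Φ e
  have hBt : IsOfTypeAt p 0 B := isOfTypeAt_of_mem_typeSubmodule rfl hB
  -- every `(p,0)`-form is primitive: `B ∧ ω^{∧(n+1)}` has type `(n+p+1, n+1)`, `n + p + 1 > dim E`
  have hprim : B.wedge (wedgePow (ofRealForm (-η₀)) (n + 1)) = 0 := by
    have h11' : ∀ x y : E, (-η₀) ![I • x, I • y] = (-η₀) ![x, y] := fun x y ↦ by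
      rw [ContinuousAlternatingMap.neg_apply, ContinuousAlternatingMap.neg_apply, h₀]
    have ht := hBt.wedge (isOfTypeAt_wedgePow (isOfTypeAt_one_one_ofRealForm h11') (n + 1))
    exact ht.eq_zero_of_finrank_lt_fst (by rw [hg]; omega)
  obtain ⟨c, hc, hval⟩ := hodgeRiemann_voisin_of_pos Φ h₀ h₀pos e (k := p) (p := p) (q := 0) (r := n)
    (by omega) h2 hBt hprim hB0
  have hsign : (-1 : ℂ) ^ (p * (p - 1) / 2) * I ^ (((p : ℕ) : ℤ) - (0 : ℕ)) = (-1 : ℂ) ^ (p.choose 2) * I ^ p := by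
    rw [Nat.choose_two_right, Nat.cast_zero, sub_zero, zpow_natCast]
  rw [hsign] at hval
  change 0 < (-1 : ℂ) ^ (p.choose 2) * I ^ p * torusIntegral Φ e
    (((wedgePow (ofRealForm (-η₀)) n).wedge (B.wedge (conjForm B))).domDomCongr (finCongr h2))
  rw [hval]
  exact_mod_cast hc

/-- **The mixed Hodge–Riemann bilinear relation in bidegree `(p,0)` on a complex torus** (Dinh–Nguyên Thm. 1.3 =
Timorin's theorem for `(p,q) = (p,0)`, where the mixed-primitivity condition is empty: `P^{p,0}(X) = H^{p,0}(X)`):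
for POSITIVE `(1,1)`-forms `η_1, …, η_n` (Kähler classes `ω_m = -η_m`) on a torus of dimension `n + p` and
`0 ≠ B ∈ H^{p,0}(X)`, **`(-1)^{p(p-1)/2} iᵖ ∫_X ω_1 ∧ ⋯ ∧ ω_n ∧ B ∧ B̄ > 0`** (Huybrechts' sign normalisation;
Dinh–Nguyên print `i^{p-q} (-1)^{(n-p-q)(n-p-q-1)/2}` in front of `∫ α ∧ β̄ ∧ Ω`). Proof as in Lange's Lemma 2.2.2
(a)(ii): `η_m - ε_m η_0 ≥ 0` for some `ε_m > 0`, expansion by `g`-linearity, every term `≥ 0` by the semi-positive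
case and the term `∏ ε_m · (unmixed number) > 0` by Voisin's Thm. 6.32.
[cite: DinhNguyen2006, §1 Theorem 1.3 and §2 Prop. 2.1 (b) (arXiv PDF pp. 3, 5)] [cite: Timorin1998, Main Theorem]
[cite: Lange2023AbelianVarietiesComplex, §2.2.1 Lemma 2.2.2 (a)(ii) and §2.2.5 Exercise (1)] -/
theorem torusIntegral_pZero_pos_of_pos {n p : ℕ} (e : Fin (2 * (n + p)) ≃ ι)
    (η : Fin n → E [⋀^Fin 2]→L[ℝ] ℝ) (h11 : ∀ m (x y : E), η m ![I • x, I • y] = η m ![x, y])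
    (hpos : ∀ m (v : E), v ≠ 0 → 0 < η m ![I • v, v]) {B : E [⋀^Fin p]→L[ℝ] ℂ}
    (hB : B ∈ typeSubmodule E p p 0) (hB0 : B ≠ 0) (h2 : 2 * n + (p + p) = 2 * (n + p)) :
    0 < (-1 : ℂ) ^ (p.choose 2) * I ^ p * torusIntegral Φ e
      (((wedgeFamily n fun m ↦ ofRealForm (-(η m))).wedge (B.wedge (conjForm B))).domDomCongr (finCongr h2)) := by
  classical
  haveI := finiteDimensional_complex Φ
  have hg : finrank ℂ E = n + p := finrank_eq_of_finTwoMulEquiv Φ e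
  obtain ⟨η₀, h₀, h₀pos⟩ := exists_pos_typeOneOne Φ
  choose ε hε hsemi using fun m ↦ exists_pos_sub_smul_semipos hg h₀ h₀pos (h11 m) (hpos m)
  -- the linear read-out `w ↦ K ∫_X w ∧ B ∧ B̄`
  obtain ⟨T, hT⟩ := exists_linear_smul_wedge_domDomCongr (E := E) ((-1 : ℂ) ^ (p.choose 2) * I ^ p)
    (B.wedge (conjForm B)) h2
  set Tint : (E [⋀^Fin (2 * n)]→L[ℝ] ℂ) →ₗ[ℂ] ℂ :=
    { toFun := fun w ↦ torusIntegral Φ e (T w)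
      map_add' := fun w w' ↦ by rw [map_add, torusIntegral_add]
      map_smul' := fun z w ↦ by rw [map_smul, torusIntegral_smul]; rfl } with hTint
  have hTint' : ∀ θ : Fin n → E [⋀^Fin 2]→L[ℝ] ℂ, Tint (wedgeFamily n θ) =
      (-1 : ℂ) ^ (p.choose 2) * I ^ p * torusIntegral Φ e
        (((wedgeFamily n θ).wedge (B.wedge (conjForm B))).domDomCongr (finCongr h2)) := fun θ ↦ by
    simp only [hTint, LinearMap.coe_mk, AddHom.coe_mk, hT, torusIntegral_smul]
  set M : Fin n → E [⋀^Fin 2]→L[ℝ] ℂ := fun m ↦ ofRealForm (-(η m - ε m • η₀)) with hM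
  set M' : Fin n → E [⋀^Fin 2]→L[ℝ] ℂ := fun m ↦ ofRealForm (-(ε m • η₀)) with hM'
  have hsplit : (fun m ↦ ofRealForm (-(η m))) = M + M' := by
    funext m
    rw [Pi.add_apply, hM, hM', ← ofRealForm_add]
    congr 1
    abel
  rw [← hTint', hsplit, linear_wedgeFamily_add]
  refine Finset.sum_pos' (fun s _ ↦ ?_) ⟨∅, Finset.mem_univ _, ?_⟩
  · -- every term is a Hodge–Riemann number with a semi-positive `(1,1)` background
    have hpw : s.piecewise M M' = fun m ↦ ofRealForm (-(if m ∈ s then η m - ε m • η₀ else ε m • η₀)) := by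
      funext m
      by_cases hm : m ∈ s
      · rw [Finset.piecewise_eq_of_mem _ _ _ hm, if_pos hm]
      · rw [Finset.piecewise_eq_of_notMem _ _ _ hm, if_neg hm]
    rw [hpw, hTint']
    refine torusIntegral_pZero_nonneg_of_semipos Φ e _ (fun m x y ↦ ?_) (fun m v ↦ ?_) hB h2
    · split_ifs
      · rw [ContinuousAlternatingMap.sub_apply, ContinuousAlternatingMap.smul_apply,
          ContinuousAlternatingMap.sub_apply, ContinuousAlternatingMap.smul_apply, h11, h₀]
      · rw [ContinuousAlternatingMap.smul_apply, ContinuousAlternatingMap.smul_apply, h₀]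
    · split_ifs with hm
      · exact hsemi m v
      · rw [ContinuousAlternatingMap.smul_apply, smul_eq_mul]
        exact mul_nonneg (hε m).le (apply_I_smul_self_nonneg_of_pos h₀pos v)
  · -- the term `s = ∅`: `∏ ε_m · (unmixed Hodge–Riemann number) > 0`
    rw [Finset.piecewise_empty]
    have hM'' : M' = fun m ↦ (ε m : ℂ) • ofRealForm (-η₀) := by
      funext m
      show ofRealForm (-(ε m • η₀)) = _
      rw [ofRealForm_neg, ofRealForm_smul, ofRealForm_neg, smul_neg]
    rw [hM'', linear_wedgeFamily_smul, hTint', smul_eq_mul]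
    exact mul_pos (Finset.prod_pos fun m _ ↦ Complex.zero_lt_real.2 (hε m))
      (torusIntegral_pZero_const_pos Φ e h₀ h₀pos hB hB0 h2)

/-- **Mixed Hodge–Riemann in bidegree `(p,0)` for polarisations**: `L_1, …, L_n` polarisations (`IsRiemannForm`)
of an abelian variety of dimension `n + p`, `0 ≠ B ∈ H^{p,0}(X)`:
`(-1)^{C(p,2)} iᵖ ∫_X c₁(L_1) ∧ ⋯ ∧ c₁(L_n) ∧ B ∧ B̄ > 0`. [cite: DinhNguyen2006, §1 Theorem 1.3 (arXiv PDF p. 3)]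
[cite: Lange2023AbelianVarietiesComplex, §2.2.1 Lemma 2.2.2 (a)(ii)] -/
theorem IsRiemannForm.torusIntegral_pZero_pos {n p : ℕ} (e : Fin (2 * (n + p)) ≃ ι)
    {η : Fin n → E [⋀^Fin 2]→L[ℝ] ℝ} (hη : ∀ m, IsRiemannForm Φ (η m)) {B : E [⋀^Fin p]→L[ℝ] ℂ}
    (hB : B ∈ typeSubmodule E p p 0) (hB0 : B ≠ 0) (h2 : 2 * n + (p + p) = 2 * (n + p)) :
    0 < (-1 : ℂ) ^ (p.choose 2) * I ^ p * torusIntegral Φ e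
      (((wedgeFamily n fun m ↦ ofRealForm (-(η m))).wedge (B.wedge (conjForm B))).domDomCongr (finCongr h2)) :=
  ComplexTorus.torusIntegral_pZero_pos_of_pos Φ e η (fun m ↦ (hη m).1) (fun m ↦ (hη m).2.2) hB hB0 h2

/-- **The Hodge–Riemann number is real and positive**: `(-1)^{C(p,2)} iᵖ ∫_X ω_1 ∧ ⋯ ∧ ω_n ∧ B ∧ B̄ = c` for a real
`c > 0` (the formulation of the tree's `hodgeRiemann_voisin_of_pos`). [cite: DinhNguyen2006, §1 Theorem 1.3 (arXiv PDF p. 3)]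
[cite: Huybrechts2005, Cor. 1.2.36] -/
theorem exists_torusIntegral_pZero_eq_of_pos {n p : ℕ} (e : Fin (2 * (n + p)) ≃ ι)
    (η : Fin n → E [⋀^Fin 2]→L[ℝ] ℝ) (h11 : ∀ m (x y : E), η m ![I • x, I • y] = η m ![x, y])
    (hpos : ∀ m (v : E), v ≠ 0 → 0 < η m ![I • v, v]) {B : E [⋀^Fin p]→L[ℝ] ℂ}
    (hB : B ∈ typeSubmodule E p p 0) (hB0 : B ≠ 0) (h2 : 2 * n + (p + p) = 2 * (n + p)) :
    ∃ c : ℝ, 0 < c ∧ (-1 : ℂ) ^ (p.choose 2) * I ^ p * torusIntegral Φ e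
      (((wedgeFamily n fun m ↦ ofRealForm (-(η m))).wedge (B.wedge (conjForm B))).domDomCongr (finCongr h2)) = c := by
  have h := torusIntegral_pZero_pos_of_pos Φ e η h11 hpos hB hB0 h2
  obtain ⟨hre, him⟩ := Complex.lt_def.1 h
  refine ⟨_, hre, Complex.ext rfl ?_⟩
  rw [Complex.ofReal_im, ← him, Complex.zero_im]

end Integral

/-! ## §4 Readings: degree one (`i ∫_X α ∧ ᾱ ∧ ω_1 ∧ ⋯ ∧ ω_n > 0` on `H^{1,0}(X)`) and bidegree `(0,p)` -/

section Readings

variable {ι : Type*} [Fintype ι] [DecidableEq ι] {E : Type*} [NormedAddCommGroup E] [NormedSpace ℂ E]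
  (Φ : (ι → ℝ) ≃L[ℝ] E)

/-- **The mixed Hodge–Riemann relation in degree one** (`(p,q) = (1,0)`: "`Q(·,·)` is positive definite on
`P^{1,0}(X) = H^{1,0}(X)`"): for positive `(1,1)`-forms `η_1, …, η_n` on a torus of dimension `n + 1` and
`0 ≠ α ∈ H^{1,0}(X)`, **`i ∫_X ω_1 ∧ ⋯ ∧ ω_n ∧ α ∧ ᾱ > 0`** — the mixed polarisation of the weight-one Hodge structure.
[cite: DinhNguyen2006, §1 Theorem 1.3 (arXiv PDF p. 3)] [cite: Timorin1998, Main Theorem]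
[cite: Lange2023AbelianVarietiesComplex, §2.2.1 Lemma 2.2.2 (a)(ii)] -/
theorem torusIntegral_oneZero_pos_of_pos {n : ℕ} (e : Fin (2 * (n + 1)) ≃ ι)
    (η : Fin n → E [⋀^Fin 2]→L[ℝ] ℝ) (h11 : ∀ m (x y : E), η m ![I • x, I • y] = η m ![x, y])
    (hpos : ∀ m (v : E), v ≠ 0 → 0 < η m ![I • v, v]) {α : E [⋀^Fin 1]→L[ℝ] ℂ}
    (hα : α ∈ typeSubmodule E 1 1 0) (hα0 : α ≠ 0) (h2 : 2 * n + (1 + 1) = 2 * (n + 1)) :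
    0 < I * torusIntegral Φ e
      (((wedgeFamily n fun m ↦ ofRealForm (-(η m))).wedge (α.wedge (conjForm α))).domDomCongr (finCongr h2)) := by
  have h := torusIntegral_pZero_pos_of_pos Φ e η h11 hpos hα hα0 h2
  rwa [show (1 : ℕ).choose 2 = 0 from rfl, pow_zero, one_mul, pow_one] at h

/-- **Degree one for polarisations**: `i ∫_X c₁(L_1) ∧ ⋯ ∧ c₁(L_n) ∧ α ∧ ᾱ > 0` for `0 ≠ α ∈ H^{1,0}(X)` on an
abelian variety of dimension `n + 1`. [cite: DinhNguyen2006, §1 Theorem 1.3 (arXiv PDF p. 3)]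
[cite: Lange2023AbelianVarietiesComplex, §2.2.1 Lemma 2.2.2 (a)(ii)] -/
theorem IsRiemannForm.torusIntegral_oneZero_pos {n : ℕ} (e : Fin (2 * (n + 1)) ≃ ι)
    {η : Fin n → E [⋀^Fin 2]→L[ℝ] ℝ} (hη : ∀ m, IsRiemannForm Φ (η m)) {α : E [⋀^Fin 1]→L[ℝ] ℂ}
    (hα : α ∈ typeSubmodule E 1 1 0) (hα0 : α ≠ 0) (h2 : 2 * n + (1 + 1) = 2 * (n + 1)) :
    0 < I * torusIntegral Φ e
      (((wedgeFamily n fun m ↦ ofRealForm (-(η m))).wedge (α.wedge (conjForm α))).domDomCongr (finCongr h2)) :=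
  ComplexTorus.torusIntegral_oneZero_pos_of_pos Φ e η (fun m ↦ (hη m).1) (fun m ↦ (hη m).2.2) hα hα0 h2

/-- **`p = 2` has the sign `+1`**: `(-1)^{C(2,2)} i² = 1`, so for `(2,0)`-classes the relation reads
`∫_X ω_1 ∧ ⋯ ∧ ω_n ∧ B ∧ B̄ > 0` (the normalisation of FILE 1's `torusIntegral_wedgeFamily_twoZero_pos_of_pos`).
[cite: Huybrechts2005, Cor. 1.2.36] [cite: DinhNguyen2006, §4 Remarks 4.2 (arXiv PDF p. 9)] -/
theorem torusIntegral_twoZero_pos_of_pos' {n : ℕ} (e : Fin (2 * (n + 2)) ≃ ι)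
    (η : Fin n → E [⋀^Fin 2]→L[ℝ] ℝ) (h11 : ∀ m (x y : E), η m ![I • x, I • y] = η m ![x, y])
    (hpos : ∀ m (v : E), v ≠ 0 → 0 < η m ![I • v, v]) {B : E [⋀^Fin 2]→L[ℝ] ℂ}
    (hB : B ∈ typeSubmodule E 2 2 0) (hB0 : B ≠ 0) (h2 : 2 * n + (2 + 2) = 2 * (n + 2)) :
    0 < torusIntegral Φ e
      (((wedgeFamily n fun m ↦ ofRealForm (-(η m))).wedge (B.wedge (conjForm B))).domDomCongr (finCongr h2)) := by
  have h := torusIntegral_pZero_pos_of_pos Φ e η h11 hpos hB hB0 h2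
  rwa [show (2 : ℕ).choose 2 = 1 from rfl, pow_one, I_sq, neg_mul, one_mul, neg_neg, one_mul] at h

omit [Fintype ι] [DecidableEq ι] in
/-- `B̄ ∧ B = (-1)ᵖ B ∧ B̄` for a `p`-form `B` (graded commutativity; `p² ≡ p (mod 2)`). [cite: WarnerGTM94, 2.6] -/
theorem conjForm_wedge_self_eq_smul {p : ℕ} (B : E [⋀^Fin p]→L[ℝ] ℂ) :
    (conjForm B).wedge B = ((-1 : ℂ) ^ p) • B.wedge (conjForm B) := by
  refine GForm.of_injective (p + p) ?_
  rw [← GForm.of_mul_of, GForm.of_mul_of_comm p p B (conjForm B), GForm.of_smul, GForm.of_mul_of,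
    ← GForm.coe_real_smul]
  push_cast
  congr 1
  rcases Nat.even_or_odd p with hp | hp
  · rw [hp.neg_one_pow, (hp.mul_left p).neg_one_pow]
  · rw [hp.neg_one_pow, (Nat.odd_mul.2 ⟨hp, hp⟩).neg_one_pow]

/-- **The mixed Hodge–Riemann relation in bidegree `(0,p)`** (by conjugation: `B ∈ Λ^{0,p}` iff `B̄ ∈ Λ^{p,0}`, and
`B̄ ∧ B = (-1)ᵖ B ∧ B̄`): for positive `η_m` and `0 ≠ B ∈ H^{0,p}(X)`,
`(-1)^{C(p,2)} (-i)ᵖ ∫_X ω_1 ∧ ⋯ ∧ ω_n ∧ B ∧ B̄ > 0` — Huybrechts' sign `(-1)^{k(k-1)/2} i^{p-q}` with `(p,q) = (0,p)`.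
[cite: DinhNguyen2006, §1 Theorem 1.3 (arXiv PDF p. 3)] [cite: Huybrechts2005, Cor. 1.2.36] [cite: VoisinHodgeI2002, §2.3.1] -/
theorem torusIntegral_zeroP_pos_of_pos {n p : ℕ} (e : Fin (2 * (n + p)) ≃ ι)
    (η : Fin n → E [⋀^Fin 2]→L[ℝ] ℝ) (h11 : ∀ m (x y : E), η m ![I • x, I • y] = η m ![x, y])
    (hpos : ∀ m (v : E), v ≠ 0 → 0 < η m ![I • v, v]) {B : E [⋀^Fin p]→L[ℝ] ℂ}
    (hB : B ∈ typeSubmodule E p 0 p) (hB0 : B ≠ 0) (h2 : 2 * n + (p + p) = 2 * (n + p)) :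
    0 < (-1 : ℂ) ^ (p.choose 2) * (-I) ^ p * torusIntegral Φ e
      (((wedgeFamily n fun m ↦ ofRealForm (-(η m))).wedge (B.wedge (conjForm B))).domDomCongr (finCongr h2)) := by
  have hBc : conjForm B ∈ typeSubmodule E p p 0 := conjForm_mem_typeSubmodule (E := E) (zero_add p) hB
  have hBc0 : conjForm B ≠ 0 := fun h ↦ hB0 (by
    rw [← Literature.LinearAlgebra.Alternating.conj_conj B, h]; ext v; simp)
  have h := torusIntegral_pZero_pos_of_pos Φ e η h11 hpos hBc hBc0 h2
  rw [Literature.LinearAlgebra.Alternating.conj_conj, conjForm_wedge_self_eq_smul, wedge_smul_right_complex] at h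
  have hdd : (((-1 : ℂ) ^ p) • ((wedgeFamily n fun m ↦ ofRealForm (-(η m))).wedge (B.wedge (conjForm B)))).domDomCongr
      (finCongr h2) = ((-1 : ℂ) ^ p) •
        (((wedgeFamily n fun m ↦ ofRealForm (-(η m))).wedge (B.wedge (conjForm B))).domDomCongr (finCongr h2)) := rfl
  rw [hdd, torusIntegral_smul] at h
  have hI : (-I) ^ p = I ^ p * (-1 : ℂ) ^ p := by rw [← mul_pow, mul_neg_one]
  rw [hI]
  calc (0 : ℂ) < (-1 : ℂ) ^ (p.choose 2) * I ^ p * ((-1 : ℂ) ^ p * torusIntegral Φ e _) := h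
    _ = _ := by ring

end Readings

end ComplexTorus

end Literature.Geometry.Kaehler

end
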